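import Summits.Ventures.CertifiedManyBodySolver.Certificates.HubbardSquare_afChord_CCOCNickelatesHg
import Summits.Ventures.CertifiedManyBodySolver.Certificates.HubbardSquare_afChord_nickelatesLowN
import Summits.Ventures.CertifiedManyBodySolver.Downfold.BoxesNdNiO2E
import Summits.Ventures.CertifiedManyBodySolver.Downfold.BoxesRNiO2Sr20E
import Summits.Ventures.CertifiedManyBodySolver.Downfold.ThermalAnnexSeam
import HarnessLib

/-!
# HYPOTHESIS-FREE TYPED T-AXIS WORDS ON THE NICKELATE BOXES: every CLOSED `T = 0` cell word (box-p2's sandwich ⋈ AF-chord words `sw_afc_*`, box-eng-1's polrow words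
# `aw_pr_*`) through the THERMAL ANNEX SEAM (`ThermalAnnexSeam.holdsOn_thermalAnnex_of_cellWord` = box-p2's `thermalWindow_of_constWord_Icc₃_decimal` on a typed box)

Venture CertifiedManyBodySolver, cell `pub/hubbard-downfold` (stage S1 ↔ S2 seam, D-0099 T axis), seat hubbard-downfold-mod-1; namespace
`Summit.Ventures.CertifiedManyBodySolver.Downfold`. For each box below the `T = 0` word `[F, C]` is unconditional, hence so is the T-axis word: for every temperature
cell `Θ = [kT₁, kT₂]` (eV, `0 < kT₁`), every `kT ∈ Θ`, member `p`, `β' ≥ p t_eV/kT`, every torus-limit canonical-SECTOR Gibbs state of the member's unit `t–t′` model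
`H(1, p tp/t, p U/t)` at `β'`, filling `p n`: **`e(ω) ∈ [F, C + 1.3863·kT₂/t₁]`** (`t₁` = the box's lower `t_eV` end; slack = `log 4 · kT₂/t₁`). Table (F, C, t₁; caps at
`T ≤ 300 K` (`kT₂ = 13/500`) and `T ≤ 100 K` (`87/10000`), 10-dp outward):
* `boxNdNiO2E_M21` (NdNiO₂ parent (#21)): [-1.6644824168, -0.5052197206], t₁ = 0.38 ⇒ 300 K cap -0.4103676153, 100 K cap -0.4734807469
* `boxNdSrNiO2E_M22` (Nd₀.₈Sr₀.₂NiO₂ (#22)): [-1.5006410886, -0.6946261067], t₁ = 0.38 ⇒ 300 K cap -0.5997740014, 100 K cap -0.6628871330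
* `boxNdSrNiO2E_M59` (Nd₀.₉Sr₀.₁NiO₂ (M59)): [-1.5997114011, -0.5943521376], t₁ = 0.38 ⇒ 300 K cap -0.4995000323, 100 K cap -0.5626131639
* `boxNdSrNiO2E_M60` (Nd₀.₇Sr₀.₃NiO₂ (M60)): [-1.4630624017, -0.7263706298], t₁ = 0.38 ⇒ 300 K cap -0.6315185245, 100 K cap -0.6946316561
* `boxLaSrNiO2E_M39a` (La₀.₈Sr₀.₂NiO₂ (M39a)): [-1.5017170388, -0.6966638066], t₁ = 0.38 ⇒ 300 K cap -0.6018117013, 100 K cap -0.6649248329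
* `boxPrSrNiO2E_M39b` (Pr₀.₈Sr₀.₂NiO₂ (M39b)): [-1.5129816694, -0.7118716064], t₁ = 0.44 ⇒ 300 K cap -0.6299538791, 100 K cap -0.6844606745
* `boxPrSrNiO2E_M39bP12` (Pr₀.₈Sr₀.₂NiO₂ @12 GPa (M39bP12)): [-1.5078273904, -0.7006539361], t₁ = 0.41 ⇒ 300 K cap -0.6127422287, 100 K cap -0.6712373263
These are WEAKER than the cold-ray words where those exist (cell #1: −0.5596 at 300 K vs −0.4685 here) but hold on EVERY listed box with NO hypothesis — the
universal T-axis fallback for the D-0099 maps. HONEST FRAMING: energy windows for torus limits of canonical-sector Gibbs states (density-keyed), in units of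
the member's `t`; object-E `t–t′` readings (boxes are S1's screening-grade typed boxes — the attachment to a material is as good as the box); nothing here is a
phase sentence, an order word or a `T_c`. Everything is PROVED; no definition, no `sorry`.
-/

noncomputable section

namespace Summit.Ventures.CertifiedManyBodySolver.Downfold

open NonemptyInterval Literature.MathematicalPhysics.QuantumLattice
  Literature.MathematicalPhysics.QuantumLattice.ThermodynamicLimit
  Literature.MathematicalPhysics.QuantumLattice.InfVolFermionState
  Literature.Probability.LatticeModels _root_.Filter
  Summit.Ventures.CertifiedManyBodySolver.Certificates

open scoped ComplexOrder

/-- **HYPOTHESIS-FREE typed T-axis word on `boxNdNiO2E_M21`** (NdNiO₂ parent (#21); `t₁ = 19/50` eV): for every temperature cell `Θ = [kT₁, kT₂]` (eV, `0 < kT₁`),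
every `kT ∈ Θ`, member `p`, `β' ≥ p t_eV/kT` and every torus-limit sector-Gibbs state of `H(1, p tp/t, p U/t)` at `β'`, filling `p n`:
**`e(ω) ∈ [-1.6644824168, -0.5052197206 + 1.3863/((19/50)/kT₂)]`** — the CLOSED `T = 0` word `sw_afc_ndnio2E_M21_word` through `holdsOn_thermalAnnex_of_cellWord`
(e.g. `T ≤ 300 K`: cap -0.4103676153; `T ≤ 100 K`: -0.4734807469). No hypothesis of any kind. [cite: Israel1979, Thm. I.3.4] [cite: Ruelle1969, §2.5–2.6] -/
theorem boxNdNiO2E_M21_thermalAnnex_closed {Θ : NonemptyInterval ℚ} (hΘ : 0 < Θ.fst) {kT : ℝ} (hk : kT ∈ Θ.ratCast ℝ) :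
    HoldsOn (fun p : OneBandCoord → ℝ => ∀ β' : ℝ, p .tEV / kT ≤ β' →
      ∀ (ω : InfVolFermionState 2) (Ls : ℕ → ℕ), Tendsto Ls atTop atTop →
        ω.IsTorusLimitOfMixture (sectorGibbsCount (p .filling))
          (fun L => sectorGibbsWeightTT' β' 1 (p .tpOverT) (p .UOverT) (p .filling) L)
          (fun L => sectorGibbsVectorTT' 1 (p .tpOverT) (p .UOverT) (p .filling) L) Ls →
        ω.meanEnergy (hubbardTTPrimeFermionInteraction 1 (p .tpOverT) (p .UOverT)) 1 ∈
          Set.Icc (-1.6644824168 : ℝ) ((-0.5052197206 : ℝ) + 1.3863 / ((((19/50 : ℚ) / Θ.snd : ℚ)) : ℝ))) boxNdNiO2E_M21 :=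
  holdsOn_thermalAnnex_of_cellWord (B := boxNdNiO2E_M21) (eU := ndNiO2E_M21_U) (eS := ndNiO2E_M21_tp) (eN := ndNiO2E_M21_n) (eT := ndNiO2E_M21_t) rfl rfl rfl rfl
    (by rw [ndNiO2E_M21_U, Entry.encl_ofEnds_fst]; norm_num) (by rw [ndNiO2E_M21_n, Entry.encl_ofEnds_fst]; norm_num)
    (by rw [ndNiO2E_M21_n, Entry.encl_ofEnds_snd]; norm_num) (by rw [ndNiO2E_M21_t, Entry.encl_ofEnds_fst]) (by norm_num)
    (by rw [ndNiO2E_M21_s2Lo, ndNiO2E_M21_s2Hi]; exact sw_afc_ndnio2E_M21_word) hΘ hk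

/-- **HYPOTHESIS-FREE typed T-axis word on `boxNdSrNiO2E_M22`** (Nd₀.₈Sr₀.₂NiO₂ (#22); `t₁ = 19/50` eV): for every temperature cell `Θ = [kT₁, kT₂]` (eV, `0 < kT₁`),
every `kT ∈ Θ`, member `p`, `β' ≥ p t_eV/kT` and every torus-limit sector-Gibbs state of `H(1, p tp/t, p U/t)` at `β'`, filling `p n`:
**`e(ω) ∈ [-1.5006410886, -0.6946261067 + 1.3863/((19/50)/kT₂)]`** — the CLOSED `T = 0` word `sw_afc_ndsrnio2E_M22_word` through `holdsOn_thermalAnnex_of_cellWord`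
(e.g. `T ≤ 300 K`: cap -0.5997740014; `T ≤ 100 K`: -0.6628871330). No hypothesis of any kind. [cite: Israel1979, Thm. I.3.4] [cite: Ruelle1969, §2.5–2.6] -/
theorem boxNdSrNiO2E_M22_thermalAnnex_closed {Θ : NonemptyInterval ℚ} (hΘ : 0 < Θ.fst) {kT : ℝ} (hk : kT ∈ Θ.ratCast ℝ) :
    HoldsOn (fun p : OneBandCoord → ℝ => ∀ β' : ℝ, p .tEV / kT ≤ β' →
      ∀ (ω : InfVolFermionState 2) (Ls : ℕ → ℕ), Tendsto Ls atTop atTop →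
        ω.IsTorusLimitOfMixture (sectorGibbsCount (p .filling))
          (fun L => sectorGibbsWeightTT' β' 1 (p .tpOverT) (p .UOverT) (p .filling) L)
          (fun L => sectorGibbsVectorTT' 1 (p .tpOverT) (p .UOverT) (p .filling) L) Ls →
        ω.meanEnergy (hubbardTTPrimeFermionInteraction 1 (p .tpOverT) (p .UOverT)) 1 ∈
          Set.Icc (-1.5006410886 : ℝ) ((-0.6946261067 : ℝ) + 1.3863 / ((((19/50 : ℚ) / Θ.snd : ℚ)) : ℝ))) boxNdSrNiO2E_M22 :=
  holdsOn_thermalAnnex_of_cellWord (B := boxNdSrNiO2E_M22) (eU := ndSrNiO2E_M22_U) (eS := ndSrNiO2E_M22_tp) (eN := ndSrNiO2E_M22_n) (eT := ndSrNiO2E_M22_t) rfl rfl rfl rfl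
    (by rw [ndSrNiO2E_M22_U, Entry.encl_ofEnds_fst]; norm_num) (by rw [ndSrNiO2E_M22_n, Entry.encl_ofEnds_fst]; norm_num)
    (by rw [ndSrNiO2E_M22_n, Entry.encl_ofEnds_snd]; norm_num) (by rw [ndSrNiO2E_M22_t, Entry.encl_ofEnds_fst]) (by norm_num)
    (by rw [ndSrNiO2E_M22_s2Lo, ndSrNiO2E_M22_s2Hi]; exact sw_afc_ndsrnio2E_M22_word) hΘ hk

/-- **HYPOTHESIS-FREE typed T-axis word on `boxNdSrNiO2E_M59`** (Nd₀.₉Sr₀.₁NiO₂ (M59); `t₁ = 19/50` eV): for every temperature cell `Θ = [kT₁, kT₂]` (eV, `0 < kT₁`),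
every `kT ∈ Θ`, member `p`, `β' ≥ p t_eV/kT` and every torus-limit sector-Gibbs state of `H(1, p tp/t, p U/t)` at `β'`, filling `p n`:
**`e(ω) ∈ [-1.5997114011, -0.5943521376 + 1.3863/((19/50)/kT₂)]`** — the CLOSED `T = 0` word `sw_afc_ndsrnio2E_M59_word` through `holdsOn_thermalAnnex_of_cellWord`
(e.g. `T ≤ 300 K`: cap -0.4995000323; `T ≤ 100 K`: -0.5626131639). No hypothesis of any kind. [cite: Israel1979, Thm. I.3.4] [cite: Ruelle1969, §2.5–2.6] -/
theorem boxNdSrNiO2E_M59_thermalAnnex_closed {Θ : NonemptyInterval ℚ} (hΘ : 0 < Θ.fst) {kT : ℝ} (hk : kT ∈ Θ.ratCast ℝ) :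
    HoldsOn (fun p : OneBandCoord → ℝ => ∀ β' : ℝ, p .tEV / kT ≤ β' →
      ∀ (ω : InfVolFermionState 2) (Ls : ℕ → ℕ), Tendsto Ls atTop atTop →
        ω.IsTorusLimitOfMixture (sectorGibbsCount (p .filling))
          (fun L => sectorGibbsWeightTT' β' 1 (p .tpOverT) (p .UOverT) (p .filling) L)
          (fun L => sectorGibbsVectorTT' 1 (p .tpOverT) (p .UOverT) (p .filling) L) Ls →
        ω.meanEnergy (hubbardTTPrimeFermionInteraction 1 (p .tpOverT) (p .UOverT)) 1 ∈
          Set.Icc (-1.5997114011 : ℝ) ((-0.5943521376 : ℝ) + 1.3863 / ((((19/50 : ℚ) / Θ.snd : ℚ)) : ℝ))) boxNdSrNiO2E_M59 :=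
  holdsOn_thermalAnnex_of_cellWord (B := boxNdSrNiO2E_M59) (eU := ndSrNiO2E_M59_U) (eS := ndSrNiO2E_M59_tp) (eN := ndSrNiO2E_M59_n) (eT := ndSrNiO2E_M59_t) rfl rfl rfl rfl
    (by rw [ndSrNiO2E_M59_U, Entry.encl_ofEnds_fst]; norm_num) (by rw [ndSrNiO2E_M59_n, Entry.encl_ofEnds_fst]; norm_num)
    (by rw [ndSrNiO2E_M59_n, Entry.encl_ofEnds_snd]; norm_num) (by rw [ndSrNiO2E_M59_t, Entry.encl_ofEnds_fst]) (by norm_num)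
    (by rw [ndSrNiO2E_M59_s2Lo, ndSrNiO2E_M59_s2Hi]; exact sw_afc_ndsrnio2E_M59_word) hΘ hk

/-- **HYPOTHESIS-FREE typed T-axis word on `boxNdSrNiO2E_M60`** (Nd₀.₇Sr₀.₃NiO₂ (M60); `t₁ = 19/50` eV): for every temperature cell `Θ = [kT₁, kT₂]` (eV, `0 < kT₁`),
every `kT ∈ Θ`, member `p`, `β' ≥ p t_eV/kT` and every torus-limit sector-Gibbs state of `H(1, p tp/t, p U/t)` at `β'`, filling `p n`:
**`e(ω) ∈ [-1.4630624017, -0.7263706298 + 1.3863/((19/50)/kT₂)]`** — the CLOSED `T = 0` word `sw_afc_ndsrnio2E_M60_word` through `holdsOn_thermalAnnex_of_cellWord`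
(e.g. `T ≤ 300 K`: cap -0.6315185245; `T ≤ 100 K`: -0.6946316561). No hypothesis of any kind. [cite: Israel1979, Thm. I.3.4] [cite: Ruelle1969, §2.5–2.6] -/
theorem boxNdSrNiO2E_M60_thermalAnnex_closed {Θ : NonemptyInterval ℚ} (hΘ : 0 < Θ.fst) {kT : ℝ} (hk : kT ∈ Θ.ratCast ℝ) :
    HoldsOn (fun p : OneBandCoord → ℝ => ∀ β' : ℝ, p .tEV / kT ≤ β' →
      ∀ (ω : InfVolFermionState 2) (Ls : ℕ → ℕ), Tendsto Ls atTop atTop →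
        ω.IsTorusLimitOfMixture (sectorGibbsCount (p .filling))
          (fun L => sectorGibbsWeightTT' β' 1 (p .tpOverT) (p .UOverT) (p .filling) L)
          (fun L => sectorGibbsVectorTT' 1 (p .tpOverT) (p .UOverT) (p .filling) L) Ls →
        ω.meanEnergy (hubbardTTPrimeFermionInteraction 1 (p .tpOverT) (p .UOverT)) 1 ∈
          Set.Icc (-1.4630624017 : ℝ) ((-0.7263706298 : ℝ) + 1.3863 / ((((19/50 : ℚ) / Θ.snd : ℚ)) : ℝ))) boxNdSrNiO2E_M60 :=
  holdsOn_thermalAnnex_of_cellWord (B := boxNdSrNiO2E_M60) (eU := ndSrNiO2E_M60_U) (eS := ndSrNiO2E_M60_tp) (eN := ndSrNiO2E_M60_n) (eT := ndSrNiO2E_M60_t) rfl rfl rfl rfl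
    (by rw [ndSrNiO2E_M60_U, Entry.encl_ofEnds_fst]; norm_num) (by rw [ndSrNiO2E_M60_n, Entry.encl_ofEnds_fst]; norm_num)
    (by rw [ndSrNiO2E_M60_n, Entry.encl_ofEnds_snd]; norm_num) (by rw [ndSrNiO2E_M60_t, Entry.encl_ofEnds_fst]) (by norm_num)
    (by rw [ndSrNiO2E_M60_s2Lo, ndSrNiO2E_M60_s2Hi]; exact sw_afc_ndsrnio2E_M60_word) hΘ hk

/-- **HYPOTHESIS-FREE typed T-axis word on `boxLaSrNiO2E_M39a`** (La₀.₈Sr₀.₂NiO₂ (M39a); `t₁ = 19/50` eV): for every temperature cell `Θ = [kT₁, kT₂]` (eV, `0 < kT₁`),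
every `kT ∈ Θ`, member `p`, `β' ≥ p t_eV/kT` and every torus-limit sector-Gibbs state of `H(1, p tp/t, p U/t)` at `β'`, filling `p n`:
**`e(ω) ∈ [-1.5017170388, -0.6966638066 + 1.3863/((19/50)/kT₂)]`** — the CLOSED `T = 0` word `sw_afc_lasrnio2E_M39a_word` through `holdsOn_thermalAnnex_of_cellWord`
(e.g. `T ≤ 300 K`: cap -0.6018117013; `T ≤ 100 K`: -0.6649248329). No hypothesis of any kind. [cite: Israel1979, Thm. I.3.4] [cite: Ruelle1969, §2.5–2.6] -/
theorem boxLaSrNiO2E_M39a_thermalAnnex_closed {Θ : NonemptyInterval ℚ} (hΘ : 0 < Θ.fst) {kT : ℝ} (hk : kT ∈ Θ.ratCast ℝ) :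
    HoldsOn (fun p : OneBandCoord → ℝ => ∀ β' : ℝ, p .tEV / kT ≤ β' →
      ∀ (ω : InfVolFermionState 2) (Ls : ℕ → ℕ), Tendsto Ls atTop atTop →
        ω.IsTorusLimitOfMixture (sectorGibbsCount (p .filling))
          (fun L => sectorGibbsWeightTT' β' 1 (p .tpOverT) (p .UOverT) (p .filling) L)
          (fun L => sectorGibbsVectorTT' 1 (p .tpOverT) (p .UOverT) (p .filling) L) Ls →
        ω.meanEnergy (hubbardTTPrimeFermionInteraction 1 (p .tpOverT) (p .UOverT)) 1 ∈
          Set.Icc (-1.5017170388 : ℝ) ((-0.6966638066 : ℝ) + 1.3863 / ((((19/50 : ℚ) / Θ.snd : ℚ)) : ℝ))) boxLaSrNiO2E_M39a :=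
  holdsOn_thermalAnnex_of_cellWord (B := boxLaSrNiO2E_M39a) (eU := laSrNiO2E_M39a_U) (eS := laSrNiO2E_M39a_tp) (eN := laSrNiO2E_M39a_n) (eT := laSrNiO2E_M39a_t) rfl rfl rfl rfl
    (by rw [laSrNiO2E_M39a_U, Entry.encl_ofEnds_fst]; norm_num) (by rw [laSrNiO2E_M39a_n, Entry.encl_ofEnds_fst]; norm_num)
    (by rw [laSrNiO2E_M39a_n, Entry.encl_ofEnds_snd]; norm_num) (by rw [laSrNiO2E_M39a_t, Entry.encl_ofEnds_fst]) (by norm_num)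
    (by rw [laSrNiO2E_M39a_s2Lo, laSrNiO2E_M39a_s2Hi]; exact sw_afc_lasrnio2E_M39a_word) hΘ hk

/-- **HYPOTHESIS-FREE typed T-axis word on `boxPrSrNiO2E_M39b`** (Pr₀.₈Sr₀.₂NiO₂ (M39b); `t₁ = 11/25` eV): for every temperature cell `Θ = [kT₁, kT₂]` (eV, `0 < kT₁`),
every `kT ∈ Θ`, member `p`, `β' ≥ p t_eV/kT` and every torus-limit sector-Gibbs state of `H(1, p tp/t, p U/t)` at `β'`, filling `p n`:
**`e(ω) ∈ [-1.5129816694, -0.7118716064 + 1.3863/((11/25)/kT₂)]`** — the CLOSED `T = 0` word `sw_afc_prsrnio2E_M39b_word` through `holdsOn_thermalAnnex_of_cellWord`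
(e.g. `T ≤ 300 K`: cap -0.6299538791; `T ≤ 100 K`: -0.6844606745). No hypothesis of any kind. [cite: Israel1979, Thm. I.3.4] [cite: Ruelle1969, §2.5–2.6] -/
theorem boxPrSrNiO2E_M39b_thermalAnnex_closed {Θ : NonemptyInterval ℚ} (hΘ : 0 < Θ.fst) {kT : ℝ} (hk : kT ∈ Θ.ratCast ℝ) :
    HoldsOn (fun p : OneBandCoord → ℝ => ∀ β' : ℝ, p .tEV / kT ≤ β' →
      ∀ (ω : InfVolFermionState 2) (Ls : ℕ → ℕ), Tendsto Ls atTop atTop →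
        ω.IsTorusLimitOfMixture (sectorGibbsCount (p .filling))
          (fun L => sectorGibbsWeightTT' β' 1 (p .tpOverT) (p .UOverT) (p .filling) L)
          (fun L => sectorGibbsVectorTT' 1 (p .tpOverT) (p .UOverT) (p .filling) L) Ls →
        ω.meanEnergy (hubbardTTPrimeFermionInteraction 1 (p .tpOverT) (p .UOverT)) 1 ∈
          Set.Icc (-1.5129816694 : ℝ) ((-0.7118716064 : ℝ) + 1.3863 / ((((11/25 : ℚ) / Θ.snd : ℚ)) : ℝ))) boxPrSrNiO2E_M39b :=
  holdsOn_thermalAnnex_of_cellWord (B := boxPrSrNiO2E_M39b) (eU := prSrNiO2E_M39b_U) (eS := prSrNiO2E_M39b_tp) (eN := prSrNiO2E_M39b_n) (eT := prSrNiO2E_M39b_t) rfl rfl rfl rfl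
    (by rw [prSrNiO2E_M39b_U, Entry.encl_ofEnds_fst]; norm_num) (by rw [prSrNiO2E_M39b_n, Entry.encl_ofEnds_fst]; norm_num)
    (by rw [prSrNiO2E_M39b_n, Entry.encl_ofEnds_snd]; norm_num) (by rw [prSrNiO2E_M39b_t, Entry.encl_ofEnds_fst]) (by norm_num)
    (by rw [prSrNiO2E_M39b_s2Lo, prSrNiO2E_M39b_s2Hi]; exact sw_afc_prsrnio2E_M39b_word) hΘ hk

/-- **HYPOTHESIS-FREE typed T-axis word on `boxPrSrNiO2E_M39bP12`** (Pr₀.₈Sr₀.₂NiO₂ @12 GPa (M39bP12); `t₁ = 41/100` eV): for every temperature cell `Θ = [kT₁, kT₂]` (eV, `0 < kT₁`),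
every `kT ∈ Θ`, member `p`, `β' ≥ p t_eV/kT` and every torus-limit sector-Gibbs state of `H(1, p tp/t, p U/t)` at `β'`, filling `p n`:
**`e(ω) ∈ [-1.5078273904, -0.7006539361 + 1.3863/((41/100)/kT₂)]`** — the CLOSED `T = 0` word `sw_afc_prsrnio2E_M39bP12_word` through `holdsOn_thermalAnnex_of_cellWord`
(e.g. `T ≤ 300 K`: cap -0.6127422287; `T ≤ 100 K`: -0.6712373263). No hypothesis of any kind. [cite: Israel1979, Thm. I.3.4] [cite: Ruelle1969, §2.5–2.6] -/
theorem boxPrSrNiO2E_M39bP12_thermalAnnex_closed {Θ : NonemptyInterval ℚ} (hΘ : 0 < Θ.fst) {kT : ℝ} (hk : kT ∈ Θ.ratCast ℝ) :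
    HoldsOn (fun p : OneBandCoord → ℝ => ∀ β' : ℝ, p .tEV / kT ≤ β' →
      ∀ (ω : InfVolFermionState 2) (Ls : ℕ → ℕ), Tendsto Ls atTop atTop →
        ω.IsTorusLimitOfMixture (sectorGibbsCount (p .filling))
          (fun L => sectorGibbsWeightTT' β' 1 (p .tpOverT) (p .UOverT) (p .filling) L)
          (fun L => sectorGibbsVectorTT' 1 (p .tpOverT) (p .UOverT) (p .filling) L) Ls →
        ω.meanEnergy (hubbardTTPrimeFermionInteraction 1 (p .tpOverT) (p .UOverT)) 1 ∈
          Set.Icc (-1.5078273904 : ℝ) ((-0.7006539361 : ℝ) + 1.3863 / ((((41/100 : ℚ) / Θ.snd : ℚ)) : ℝ))) boxPrSrNiO2E_M39bP12 :=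
  holdsOn_thermalAnnex_of_cellWord (B := boxPrSrNiO2E_M39bP12) (eU := prSrNiO2E_M39bP12_U) (eS := prSrNiO2E_M39bP12_tp) (eN := prSrNiO2E_M39bP12_n) (eT := prSrNiO2E_M39bP12_t) rfl rfl rfl rfl
    (by rw [prSrNiO2E_M39bP12_U, Entry.encl_ofEnds_fst]; norm_num) (by rw [prSrNiO2E_M39bP12_n, Entry.encl_ofEnds_fst]; norm_num)
    (by rw [prSrNiO2E_M39bP12_n, Entry.encl_ofEnds_snd]; norm_num) (by rw [prSrNiO2E_M39bP12_t, Entry.encl_ofEnds_fst]) (by norm_num)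
    (by rw [prSrNiO2E_M39bP12_s2Lo, prSrNiO2E_M39bP12_s2Hi]; exact sw_afc_prsrnio2E_M39bP12_word) hΘ hk

end Summit.Ventures.CertifiedManyBodySolver.Downfold

end
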